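import Summits.PneNP.PneNP.Theorems.CodingVolumeShiftsCodingVolumeLinearCount

/-!
# Route CodingVolumeShifts — crux `CodingVolume` (stmt-PneNP-19454): the three global counts of a
# level (linear one-shot codes)

Part 5 of the `C = 4` rung for LINEAR one-shot codes. For a level `r` (commodities `A_r` whose
sources first enter the middle of the network at rank `r`):

* `codingVolume_linear_sum_T` — effective arcs out of the level-`r` sources: summing over middle
  vertices the number of level-`r` commodities entering there gives `≥ |A_r| + |A_r \ A1|`
  (`A1` = commodities entering at a single vertex);
* `codingVolume_linear_sum_SU` — DEPARTURE: `|A1| ≤ Σ_{v middle} finrank (g (SU v))`, by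
  `codingVolume_level_departure` and sub-additivity of dimension;
* `codingVolume_linear_sinks` — in-arcs of the level-`r` sinks plus pure sinks recorded at their
  feeders: `≥ 2|A_r|`.

No definitions.
-/

set_option linter.dupNamespace false -- `Summit.PneNP.PneNP.…`: summit = sub-problem name (D-0017)

namespace Summit.PneNP.PneNP.Theorems

open Literature.InformationTheory.NetworkCoding Module Submodule Finset

section Four

variable {K : Type*} [Field K] {ι : Type} [Fintype ι] [DecidableEq ι] {N : KPairsNet ι}
  {φ : N.A → Module.Dual K (ι → K)}

open scoped Classical in
/-- EFFECTIVE ARCS OUT OF THE LEVEL-`r` SOURCES. Summing over the middle vertices `v` the number of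
level-`r` commodities with an effective arc into `v` counts every level-`r` commodity at least once,
and those entering the middle at two or more vertices at least twice. [folklore] -/
theorem codingVolume_linear_sum_T (hr : ι → ℕ)
    (hrA : ∀ i, ∃ a, N.src a = N.source i ∧ (∀ l, N.tgt a ≠ N.sink l) ∧ φ a ≠ 0 ∧
      N.rank (N.tgt a) = hr i)
    (r : ℕ) (A1 : Finset ι)
    (hA1 : ∀ j, j ∈ A1 ↔ hr j = r ∧ ∀ a a', N.src a = N.source j → N.src a' = N.source j →
      (∀ l, N.tgt a ≠ N.sink l) → (∀ l, N.tgt a' ≠ N.sink l) → φ a ≠ 0 → φ a' ≠ 0 →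
      N.tgt a = N.tgt a') :
    (univ.filter fun i => hr i = r).card + ((univ.filter fun i => hr i = r).filter (· ∉ A1)).card ≤
      ∑ v ∈ univ.filter (fun v : N.V => (∀ j, v ≠ N.source j) ∧ ∀ j, v ≠ N.sink j),
        ((univ.filter fun i => hr i = r).filter
          (fun i => ∃ a, N.src a = N.source i ∧ N.tgt a = v ∧ φ a ≠ 0)).card := by
  classical
  set A := univ.filter (fun i => hr i = r) with hA
  set Mset := univ.filter (fun v : N.V => (∀ j, v ≠ N.source j) ∧ ∀ j, v ≠ N.sink j) with hM
  -- double counting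
  have hswap : ∑ v ∈ Mset, (A.filter (fun i => ∃ a, N.src a = N.source i ∧ N.tgt a = v ∧
      φ a ≠ 0)).card = ∑ i ∈ A, (Mset.filter (fun v => ∃ a, N.src a = N.source i ∧ N.tgt a = v ∧
      φ a ≠ 0)).card := by
    simp_rw [Finset.card_filter]
    exact Finset.sum_comm
  rw [hswap]
  -- per commodity
  have hper : ∀ i ∈ A, 1 + (if i ∉ A1 then 1 else 0) ≤
      (Mset.filter (fun v => ∃ a, N.src a = N.source i ∧ N.tgt a = v ∧ φ a ≠ 0)).card := by
    intro i hi
    have hir : hr i = r := (Finset.mem_filter.mp hi).2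
    have hmemM : ∀ a, N.src a = N.source i → (∀ l, N.tgt a ≠ N.sink l) → φ a ≠ 0 →
        N.tgt a ∈ Mset.filter (fun v => ∃ a, N.src a = N.source i ∧ N.tgt a = v ∧ φ a ≠ 0) := by
      intro a ha haM hz
      rw [Finset.mem_filter, hM, Finset.mem_filter]
      exact ⟨⟨Finset.mem_univ _, fun j h => N.source_in a j h, fun j h => haM j h⟩, a, ha, rfl, hz⟩
    obtain ⟨a, ha, haM, hz, -⟩ := hrA i
    by_cases hiA : i ∈ A1
    · rw [if_neg (not_not.mpr hiA), Nat.add_zero]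
      exact Finset.card_pos.mpr ⟨_, hmemM a ha haM hz⟩
    · -- not in `A1`: two effective arcs with different middle heads
      rw [if_pos hiA]
      have : ¬ ∀ a a', N.src a = N.source i → N.src a' = N.source i →
          (∀ l, N.tgt a ≠ N.sink l) → (∀ l, N.tgt a' ≠ N.sink l) → φ a ≠ 0 → φ a' ≠ 0 →
          N.tgt a = N.tgt a' := fun h => hiA ((hA1 i).mpr ⟨hir, h⟩)
      push Not at this
      obtain ⟨b, b', hb, hb', hbM, hb'M, hbz, hb'z, hne⟩ := this
      rw [show (1 : ℕ) + 1 = ({N.tgt b, N.tgt b'} : Finset N.V).card by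
        rw [Finset.card_pair hne]]
      refine Finset.card_le_card ?_
      intro v hv
      rcases Finset.mem_insert.mp hv with rfl | hv
      · exact hmemM b hb hbM hbz
      · rw [Finset.mem_singleton] at hv; subst hv; exact hmemM b' hb' hb'M hb'z
  calc A.card + (A.filter (· ∉ A1)).card
      = ∑ i ∈ A, (1 + if i ∉ A1 then 1 else 0) := by
        rw [Finset.sum_add_distrib, Finset.card_eq_sum_ones, Finset.card_filter]
    _ ≤ _ := Finset.sum_le_sum hper

/-- **DEPARTURE COUNT.** With `A1` the level-`r` commodities entering the middle of the network at a
single vertex and `g` the projection onto their coordinates: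
`|A1| ≤ Σ_{v middle} finrank (g (SU v))`, `SU v` the span (mod level `< r`) of the labels on arcs
from rank-`r` middle vertices into `v` — by `codingVolume_level_departure` the coordinate span of
`A1` is contained in the supremum of these subspaces. [folklore] -/
theorem codingVolume_linear_sum_SU
    (hloc : ∀ b, φ b ∈ span K (φ '' ↑(N.inArcs (N.src b)) ∪
      (fun i => (LinearMap.proj i : Module.Dual K (ι → K))) '' {i | N.source i = N.src b}))
    (hdec : ∀ i, (LinearMap.proj i : Module.Dual K (ι → K)) ∈
      span K (φ '' ↑(N.inArcs (N.sink i))))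
    (hfar : N.Far 4) (hr : ι → ℕ)
    (hrA : ∀ i, ∃ a, N.src a = N.source i ∧ (∀ l, N.tgt a ≠ N.sink l) ∧ φ a ≠ 0 ∧
      N.rank (N.tgt a) = hr i)
    (hhr : ∀ i a, N.src a = N.source i → (∀ l, N.tgt a ≠ N.sink l) → φ a ≠ 0 →
      hr i ≤ N.rank (N.tgt a))
    (r : ℕ) {f g : Module.Dual K (ι → K) →ₗ[K] Module.Dual K (ι → K)}
    (hf : ∀ i, f (LinearMap.proj i) = if i ∈ {j | hr j < r} then 0 else LinearMap.proj i)
    (A1 : Finset ι)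
    (hA1 : ∀ j, j ∈ A1 ↔ hr j = r ∧ ∀ a a', N.src a = N.source j → N.src a' = N.source j →
      (∀ l, N.tgt a ≠ N.sink l) → (∀ l, N.tgt a' ≠ N.sink l) → φ a ≠ 0 → φ a' ≠ 0 →
      N.tgt a = N.tgt a')
    (hg : ∀ i, g (LinearMap.proj i) = if i ∈ {j | j ∉ A1} then 0 else LinearMap.proj i) :
    A1.card ≤ ∑ v ∈ univ.filter (fun v : N.V => (∀ j, v ≠ N.source j) ∧ ∀ j, v ≠ N.sink j),
      finrank K (((span K (φ '' {b | N.tgt b = v ∧ (∀ j, N.src b ≠ N.source j) ∧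
        N.rank (N.src b) = r})).map f).map g) := by
  classical
  set Mset := univ.filter (fun v : N.V => (∀ j, v ≠ N.source j) ∧ ∀ j, v ≠ N.sink j) with hM
  set SUg : N.V → Submodule K (Module.Dual K (ι → K)) := fun v =>
    ((span K (φ '' {b | N.tgt b = v ∧ (∀ j, N.src b ≠ N.source j) ∧
      N.rank (N.src b) = r})).map f).map g with hSUg
  set Tgt : Submodule K (Module.Dual K (ι → K)) :=
    (span K (φ '' {a | (∀ j, N.tgt a ≠ N.source j) ∧ (∀ j, N.tgt a ≠ N.sink j) ∧
      (∀ j, N.src a ≠ N.source j) ∧ N.rank (N.src a) = r})).map (g.comp f) with hTgt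
  -- hypotheses of the departure lemma
  have hA1r : ∀ j ∈ A1, hr j = r := fun j hj => ((hA1 j).mp hj).1
  have hA1u : ∀ j ∈ A1, ∀ a a', N.src a = N.source j → N.src a' = N.source j →
      (∀ l, N.tgt a ≠ N.sink l) → (∀ l, N.tgt a' ≠ N.sink l) → φ a ≠ 0 → φ a' ≠ 0 →
      N.tgt a = N.tgt a' := fun j hj => ((hA1 j).mp hj).2
  have hA1e : ∀ j ∈ A1, ∃ a, N.src a = N.source j ∧ (∀ l, N.tgt a ≠ N.sink l) ∧ φ a ≠ 0 :=
    fun j _ => (hrA j).imp fun a ha => ⟨ha.1, ha.2.1, ha.2.2.1⟩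
  have hA1' : ∀ j ∈ A1, ∀ a, N.src a = N.source j → (∀ l, N.tgt a ≠ N.sink l) → φ a ≠ 0 →
      N.rank (N.tgt a) = r := by
    intro j hj a ha hM hz
    obtain ⟨a₀, ha₀, hM₀, hz₀, hrk₀⟩ := hrA j
    rw [hA1u j hj a a₀ ha ha₀ hM hM₀ hz hz₀, hrk₀, hA1r j hj]
  -- `span (proj '' A1) ≤ Tgt ≤ ⨆_{v ∈ Mset} SUg v`
  have h1 : span K ((fun i => (LinearMap.proj i : Module.Dual K (ι → K))) '' ↑A1) ≤ Tgt := by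
    refine span_le.mpr ?_
    rintro ψ ⟨i, hi, rfl⟩
    exact codingVolume_level_departure hloc hdec hr hhr r hf A1 hg hA1r hA1' hA1u hA1e hfar i hi
  have h2 : Tgt ≤ ⨆ v ∈ Mset, SUg v := by
    rw [hTgt, map_le_iff_le_comap]
    refine span_le.mpr ?_
    rintro ψ ⟨b, ⟨hb1, hb2, hb3, hb4⟩, rfl⟩
    rw [SetLike.mem_coe, mem_comap, LinearMap.comp_apply]
    have hv : N.tgt b ∈ Mset := by
      rw [hM, Finset.mem_filter]; exact ⟨Finset.mem_univ _, hb1, hb2⟩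
    have hmem : g (f (φ b)) ∈ SUg (N.tgt b) :=
      mem_map_of_mem (mem_map_of_mem (subset_span ⟨b, ⟨rfl, hb3, hb4⟩, rfl⟩))
    exact (le_biSup SUg hv) hmem
  calc A1.card = finrank K (span K ((fun i => (LinearMap.proj i : Module.Dual K (ι → K))) ''
        ↑A1)) := (codingVolume_finrank_span_proj A1).symm
    _ ≤ finrank K (⨆ v ∈ Mset, SUg v : Submodule K _) := Submodule.finrank_mono (h1.trans h2)
    _ ≤ ∑ v ∈ Mset, finrank K (SUg v) := codingVolume_finrank_biSup_le_sum Mset SUg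

/-- SINKS OF LEVEL `r`: the in-arcs of the sinks of the level-`r` commodities, plus the number of
those sinks with a single in-arc (each recorded at the middle vertex feeding it), are at least
`2·|A_r|`. [folklore] -/
theorem codingVolume_linear_sinks
    (hloc : ∀ b, φ b ∈ span K (φ '' ↑(N.inArcs (N.src b)) ∪
      (fun i => (LinearMap.proj i : Module.Dual K (ι → K))) '' {i | N.source i = N.src b}))
    (hdec : ∀ i, (LinearMap.proj i : Module.Dual K (ι → K)) ∈
      span K (φ '' ↑(N.inArcs (N.sink i))))
    (hfar : N.Far 4) (hr : ι → ℕ) (r : ℕ) :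
    2 * (univ.filter fun i => hr i = r).card ≤
      ∑ i ∈ univ.filter (fun i => hr i = r), (N.inArcs (N.sink i)).card +
      ∑ v ∈ univ.filter (fun v : N.V => (∀ j, v ≠ N.source j) ∧ ∀ j, v ≠ N.sink j),
        ((univ.filter fun i => hr i = r).filter (fun i => (N.inArcs (N.sink i)).card ≤ 1 ∧
          ∃ b ∈ N.inArcs (N.sink i), N.src b = v)).card := by
  classical
  set A := univ.filter (fun i => hr i = r) with hA
  set Mset := univ.filter (fun v : N.V => (∀ j, v ≠ N.source j) ∧ ∀ j, v ≠ N.sink j) with hM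
  set Pure := A.filter (fun i => (N.inArcs (N.sink i)).card ≤ 1) with hPure
  have hfar2 : ∀ i, (2 : ℕ∞) ≤ N.graph.edist (N.source i) (N.sink i) := fun i =>
    le_trans (by exact_mod_cast (by norm_num : (2 : ℕ) ≤ 4)) (hfar i)
  -- per sink: `|In| + [pure] ≥ 2`
  have hper : ∀ i ∈ A, 2 ≤ (N.inArcs (N.sink i)).card + (if i ∈ Pure then 1 else 0) := by
    intro i hi
    by_cases hc : (N.inArcs (N.sink i)).card ≤ 1
    · obtain ⟨b, hb, -⟩ := codingVolume_pure_sink hloc hdec i (hfar2 i) hc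
      have hmem : i ∈ Pure := by rw [hPure, Finset.mem_filter]; exact ⟨hi, hc⟩
      rw [if_pos hmem, hb, Finset.card_singleton]
    · push Not at hc
      omega
  have h1 : 2 * A.card ≤ ∑ i ∈ A, (N.inArcs (N.sink i)).card + Pure.card := by
    calc 2 * A.card = ∑ _i ∈ A, 2 := by simp [mul_comm]
      _ ≤ ∑ i ∈ A, ((N.inArcs (N.sink i)).card + if i ∈ Pure then 1 else 0) :=
          Finset.sum_le_sum hper
      _ = ∑ i ∈ A, (N.inArcs (N.sink i)).card + Pure.card := by
          rw [Finset.sum_add_distrib, Finset.sum_ite_mem,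
            Finset.inter_eq_right.mpr (Finset.filter_subset _ _), Finset.card_eq_sum_ones]
  -- the pure sinks are recorded at the middle vertices feeding them
  have h2 : Pure.card ≤ ∑ v ∈ Mset, (A.filter (fun i => (N.inArcs (N.sink i)).card ≤ 1 ∧
      ∃ b ∈ N.inArcs (N.sink i), N.src b = v)).card := by
    refine le_trans (Finset.card_le_card ?_) Finset.card_biUnion_le
    intro i hi
    rw [hPure, Finset.mem_filter] at hi
    obtain ⟨b, hb, hbs, hbt, -⟩ := codingVolume_pure_sink hloc hdec i (hfar2 i) hi.2
    rw [Finset.mem_biUnion]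
    refine ⟨N.src b, ?_, ?_⟩
    · rw [hM, Finset.mem_filter]
      exact ⟨Finset.mem_univ _, fun j h => hbs j h, fun j h => hbt j h⟩
    · rw [Finset.mem_filter]
      exact ⟨hi.1, hi.2, b, by rw [hb]; exact Finset.mem_singleton_self b, rfl⟩
  omega

end Four

end Summit.PneNP.PneNP.Theorems
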